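import Summits.QuantumFields.YangMills.Theorems.DiagonalMirrorRPR.Negative.InfiniteCouplingSlice
import Literature.MathematicalPhysics.QuantumLattice.SchwingerOSCluster

/-!
# `DiagonalMirrorRPR` — the phantom functional `T₃` (negative-lemma infrastructure, part 1 of 3)

Supports crux item `stmt-QuantumFields-10604` (`PencilRigidity.DiagonalMirrorRPR` =
`MirrorModularBoosts.DiagonalMirrorRPR`). Parts: this file (the functional), `PhantomFamily` (the family and
the clauses of `W₁ ∖ hconv` it carries), `HconvLoadBearing` (the diagonal frame sees it; conclusion).

Contents: the finite subtype `SignedPerm` of signed-permutation isometries of `ℝ⁴` (`W(B₄)`; finiteness by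
the injective signature into `{±e_j}⁴`, `compEquiv` = reindexing by left composition); the carrier plane
`V = Ψ(ℝ⁴ × ℝ⁴) = {(a, a + v¹e₁, a + v⁰e₀ + v²e₂ + v³e₃)} ⊂ 𝒩 = {3-point configurations in which every axis
carries a coincidence}` (`Ψ_coincidence`); the tempered functional `I F = ∫ F ∘ Ψ` (Schwartz composition with
the proper linear map `Ψ`, `norm_le_Ψ`); the average `T₃ = ∑_{g ∈ W(B₄)} ∑_{τ ∈ S₃} I ∘ permTest τ ∘ linActMulti g`
with its invariances (`T₃_permTest`, `T₃_linActMulti`, `T₃_translateMulti`); the BLIND SPOT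
`T₃_eq_zero_of_isTimeSeparated`: `T₃ F = 0` whenever the times are pairwise distinct on `{F ≠ 0}` (a signed
permutation turns some axis, which carries a coincidence on `𝒩`, into time); and the diagonal frame
`exists_frame` / `frame_time` used in part 3.
-/

noncomputable section

open scoped SchwartzMap ComplexConjugate InnerProductSpace
open MeasureTheory Filter Topology Complex
open Literature.MathematicalPhysics.QuantumLattice Literature.MathematicalPhysics.AQFT
  Literature.MathematicalPhysics.QuantumFieldTheory

namespace Summit.QuantumFields.YangMills.Theorems.DiagonalMirrorRPR.Negative

namespace Phantom

/-! ## 1. Signed permutations of `ℝ⁴` -/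


/-- The unit vector `e_i`. [folklore] -/
abbrev e (i : Fin 4) : E4 := EuclideanSpace.single i 1

/-- Signed permutation isometries (the hyperoctahedral group `W(B₄)`, improper ones included), as the
subtype the crux's `W₁` quantifies over. [folklore] -/
def SignedPerm : Type := {g : E4 ≃ₗᵢ[ℝ] E4 // ∀ i : Fin 4, ∃ j : Fin 4, g (e i) = e j ∨ g (e i) = -e j}

namespace SignedPerm

/-- The identity. [folklore] -/
def one : SignedPerm := ⟨LinearIsometryEquiv.refl ℝ E4, fun i => ⟨i, Or.inl rfl⟩⟩

/-- Closure under composition (`R.trans g = g ∘ R`). [folklore] -/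
def comp (R g : SignedPerm) : SignedPerm :=
  ⟨R.1.trans g.1, fun i => by
    obtain ⟨j, hj⟩ := R.2 i
    obtain ⟨k, hk⟩ := g.2 j
    refine ⟨k, ?_⟩
    have h1 : (R.1.trans g.1) (e i) = g.1 (R.1 (e i)) := rfl
    rw [h1]
    rcases hj with hj | hj
    · rw [hj]; exact hk
    · rw [hj, map_neg]
      rcases hk with hk | hk
      · right; rw [hk]
      · left; rw [hk, neg_neg]⟩

/-- The finite set `{± e_j}`. [folklore] -/
def pm : Set E4 := Set.range fun p : Fin 4 × Bool => if p.2 then e p.1 else -e p.1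

/-- `{± e_j}` is finite. [folklore] -/
instance : Finite pm := (Set.finite_range _).to_subtype

/-- The signature `i ↦ g eᵢ ∈ {± e_j}`. [folklore] -/
def sig (g : SignedPerm) : Fin 4 → pm := fun i =>
  ⟨g.1 (e i), by
    obtain ⟨j, hj⟩ := g.2 i
    rcases hj with hj | hj
    · exact ⟨(j, true), hj.symm⟩
    · exact ⟨(j, false), hj.symm⟩⟩

/-- A signed permutation is determined by its values on the basis. [folklore] -/
theorem sig_injective : Function.Injective sig := by
  intro g g' h
  have hb : ∀ i, g.1 (e i) = g'.1 (e i) := fun i => by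
    have := congrFun h i
    rwa [Subtype.ext_iff] at this
  apply Subtype.ext
  apply LinearIsometryEquiv.toLinearEquiv_injective
  apply LinearEquiv.toLinearMap_injective
  refine (EuclideanSpace.basisFun (Fin 4) ℝ).toBasis.ext fun i => ?_
  change g.1 ((EuclideanSpace.basisFun (Fin 4) ℝ).toBasis i) = g'.1 ((EuclideanSpace.basisFun (Fin 4) ℝ).toBasis i)
  rw [OrthonormalBasis.coe_toBasis, EuclideanSpace.basisFun_apply]
  exact hb i

/-- `W(B₄)` is finite. [folklore] -/
instance : Finite SignedPerm := Finite.of_injective sig sig_injective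

/-- `W(B₄)` as a `Fintype` (noncomputably). [folklore] -/
instance : Fintype SignedPerm := Fintype.ofFinite _

/-- Left composition by `R` is a bijection of `SignedPerm`. [folklore] -/
def compEquiv (R : SignedPerm) : SignedPerm ≃ SignedPerm :=
  Equiv.ofBijective (comp R) (Finite.injective_iff_bijective.1 fun g g' h => by
    apply Subtype.ext
    have h1 : R.1.trans g.1 = R.1.trans g'.1 := congrArg Subtype.val h
    refine LinearIsometryEquiv.ext fun x => ?_
    have := congrArg (fun (T : E4 ≃ₗᵢ[ℝ] E4) => T (R.1.symm x)) h1
    simpa using this)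

/-- `compEquiv R g = R.trans g`. [folklore] -/
@[simp] theorem compEquiv_apply_val (R g : SignedPerm) : ((compEquiv R g).1 : E4 ≃ₗᵢ[ℝ] E4) = R.1.trans g.1 := rfl

/-- Time coordinate after a signed permutation: `(g⁻¹ v)⁰ = ± v_j` where `g e₀ = ± e_j`. [folklore] -/
theorem symm_apply_zero (g : SignedPerm) :
    ∃ (j : Fin 4) (ε : ℝ), (ε = 1 ∨ ε = -1) ∧ ∀ v : E4, (g.1.symm v) 0 = ε * v j := by
  obtain ⟨j, hj⟩ := g.2 0
  have key : ∀ v : E4, (g.1.symm v) 0 = ⟪v, g.1 (e 0)⟫_ℝ := fun v => by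
    have h1 : (g.1.symm v) 0 = ⟪g.1.symm v, e 0⟫_ℝ := by
      rw [EuclideanSpace.inner_single_right]; simp
    rw [h1, LinearIsometryEquiv.inner_map_eq_flip, LinearIsometryEquiv.symm_symm]
  rcases hj with hj | hj
  · refine ⟨j, 1, Or.inl rfl, fun v => ?_⟩
    rw [key, hj, EuclideanSpace.inner_single_right]; simp
  · refine ⟨j, -1, Or.inr rfl, fun v => ?_⟩
    rw [key, hj, inner_neg_right, EuclideanSpace.inner_single_right]; simp

end SignedPerm

/-! ## 2. The carrier subspace `V ⊂ 𝒩` and the integration functional `I` -/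

/-- Coordinate projection onto the axes in `S`: `(P_S v)^μ = v^μ` for `μ ∈ S`, else `0`. [folklore] -/
def proj (S : Finset (Fin 4)) : E4 →L[ℝ] E4 :=
  LinearMap.toContinuousLinearMap
    { toFun := fun v => WithLp.toLp 2 fun ν => if ν ∈ S then v ν else 0
      map_add' := fun v w => by
        ext ν; by_cases h : ν ∈ S <;> simp [h]
      map_smul' := fun c v => by
        ext ν; by_cases h : ν ∈ S <;> simp [h] }

/-- Coordinates of `proj S v`. [folklore] -/
@[simp] theorem proj_apply (S : Finset (Fin 4)) (v : E4) (ν : Fin 4) :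
    proj S v ν = if ν ∈ S then v ν else 0 := rfl

/-- Parameter space `ℝ⁴ × ℝ⁴` (as `Fin 2 → ℝ⁴`: base point `z 0`, relative data `z 1`). [folklore] -/
abbrev Z8 : Type := Fin 2 → E4

/-- The two coordinate projections of `Z8`. [folklore] -/
def pr (k : Fin 2) : Z8 →L[ℝ] E4 := ContinuousLinearMap.proj (R := ℝ) (φ := fun _ : Fin 2 => E4) k

/-- `pr k z = z k`. [folklore] -/
@[simp] theorem pr_apply (k : Fin 2) (z : Z8) : pr k z = z k := rfl

/-- `Ψ z = (a, a + P_{1} v, a + P_{0,2,3} v)` with `a = z 0`, `v = z 1`: the three points agree on axes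
`0,2,3` (first two) and on axis `1` (first and third), so `Ψ z ∈ 𝒩` — every axis carries a coincidence —
while their diagonal times `x⁰ + x¹` are generically pairwise distinct. [folklore] -/
def Ψ : Z8 →L[ℝ] (Fin 3 → E4) :=
  ContinuousLinearMap.pi ![pr 0, pr 0 + (proj {1}).comp (pr 1), pr 0 + (proj {0, 2, 3}).comp (pr 1)]

/-- First point of `Ψ z`: the base point. [folklore] -/
theorem Ψ_apply_zero (z : Z8) : Ψ z 0 = z 0 := rfl
/-- Second point of `Ψ z`: base point moved along `e₁`. [folklore] -/
theorem Ψ_apply_one (z : Z8) : Ψ z 1 = z 0 + proj {1} (z 1) := rfl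
/-- Third point of `Ψ z`: base point moved along `e₀, e₂, e₃`. [folklore] -/
theorem Ψ_apply_two (z : Z8) : Ψ z 2 = z 0 + proj {0, 2, 3} (z 1) := rfl

/-- Every axis carries a coincidence on `Ψ z`. [folklore] -/
theorem Ψ_coincidence (z : Z8) (j : Fin 4) :
    ∃ i₁ i₂ : Fin 3, i₁ ≠ i₂ ∧ Ψ z i₁ j = Ψ z i₂ j := by
  by_cases hj : j = 1
  · subst hj
    refine ⟨0, 2, by decide, ?_⟩
    rw [Ψ_apply_zero, Ψ_apply_two, PiLp.add_apply, proj_apply]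
    simp
  · refine ⟨0, 1, by decide, ?_⟩
    rw [Ψ_apply_zero, Ψ_apply_one, PiLp.add_apply, proj_apply]
    simp [Finset.mem_singleton, hj]

/-- `Ψ` loses no information: `‖z‖ ≤ 4 (1 + ‖Ψ z‖)`. [folklore] -/
theorem norm_le_Ψ (z : Z8) : ‖z‖ ≤ 4 * (1 + ‖Ψ z‖) ^ 1 := by
  have h0 : ‖z 0‖ ≤ ‖Ψ z‖ := by
    have := norm_le_pi_norm (Ψ z) 0
    rwa [Ψ_apply_zero] at this
  have hv : z 1 = (Ψ z 1 - Ψ z 0) + (Ψ z 2 - Ψ z 0) := by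
    rw [Ψ_apply_zero, Ψ_apply_one, Ψ_apply_two, add_sub_cancel_left, add_sub_cancel_left]
    ext ν
    rw [PiLp.add_apply, proj_apply, proj_apply]
    fin_cases ν <;> simp
  have h1 : ‖z 1‖ ≤ 4 * ‖Ψ z‖ := by
    rw [hv]
    calc ‖(Ψ z 1 - Ψ z 0) + (Ψ z 2 - Ψ z 0)‖ ≤ ‖Ψ z 1 - Ψ z 0‖ + ‖Ψ z 2 - Ψ z 0‖ := norm_add_le _ _
      _ ≤ (‖Ψ z 1‖ + ‖Ψ z 0‖) + (‖Ψ z 2‖ + ‖Ψ z 0‖) := add_le_add (norm_sub_le _ _) (norm_sub_le _ _)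
      _ ≤ (‖Ψ z‖ + ‖Ψ z‖) + (‖Ψ z‖ + ‖Ψ z‖) := by
          gcongr <;> exact norm_le_pi_norm (Ψ z) _
      _ = 4 * ‖Ψ z‖ := by ring
  have hn : 0 ≤ ‖Ψ z‖ := norm_nonneg _
  rw [pow_one]
  refine (pi_norm_le_iff_of_nonneg (by positivity)).2 fun i => ?_
  fin_cases i
  · show ‖z 0‖ ≤ _ ; nlinarith
  · show ‖z 1‖ ≤ _ ; nlinarith

/-- Lebesgue measure on `ℝ⁴ × ℝ⁴` has temperate growth. [folklore] -/
instance Z8_hasTemperateGrowth : (volume : Measure Z8).HasTemperateGrowth :=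
  Measure.IsAddHaarMeasure.instHasTemperateGrowth

/-- `I(F) = ∫_{ℝ⁴ × ℝ⁴} F(Ψ z) dz`: Lebesgue integration over the 8-dimensional subspace `V = Ψ(ℝ⁸) ⊂ 𝒩`. [folklore] -/
def I : 𝓢((Fin 3 → E4), ℂ) →L[ℂ] ℂ :=
  (SchwartzMap.integralCLM ℂ (volume : Measure Z8)).comp
    (SchwartzMap.compCLM ℂ (g := fun z : Z8 => Ψ z) Ψ.hasTemperateGrowth ⟨1, 4, norm_le_Ψ⟩)

/-- `I F = ∫ F ∘ Ψ`. [folklore] -/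
theorem I_apply (F : 𝓢((Fin 3 → E4), ℂ)) : I F = ∫ z : Z8, F (Ψ z) := by
  simp [I]

/-- The diagonal base point `(b, 0)`. [folklore] -/
def base (b : E4) : Z8 := ![b, 0]

/-- `Ψ (b, 0)` is the diagonal point `(b, b, b)`. [folklore] -/
theorem Ψ_base (b : E4) : Ψ (base b) = fun _ => b := by
  funext i
  fin_cases i
  · rfl
  · show Ψ (base b) 1 = b
    rw [Ψ_apply_one]; simp [base]
  · show Ψ (base b) 2 = b
    rw [Ψ_apply_two]; simp [base]

/-- `I` is translation invariant (the diagonal `(b,b,b) = Ψ(b,0)` lies in `V`). [folklore] -/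
theorem I_translateMulti (b : E4) (F : 𝓢((Fin 3 → E4), ℂ)) : I (translateMulti b F) = I F := by
  rw [I_apply, I_apply]
  have h : ∀ z : Z8, translateMulti b F (Ψ z) = (fun w : Z8 => F (Ψ w)) (z - base b) := by
    intro z
    rw [translateMulti_apply]
    show F _ = F _
    congr 1
    rw [map_sub, Ψ_base]
    rfl
  simp_rw [h]
  exact integral_sub_right_eq_self (fun w : Z8 => F (Ψ w)) (base b)

/-! ## 3. The averaged functional `T₃` and its invariances -/

/-- `T₃ = ∑_{g ∈ W(B₄)} ∑_{τ ∈ S₃} I ∘ permTest τ ∘ linActMulti g`. [folklore] -/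
def T₃ : 𝓢((Fin 3 → E4), ℂ) →L[ℂ] ℂ :=
  ∑ g : SignedPerm, ∑ τ : Equiv.Perm (Fin 3), I.comp ((permTest τ).comp (linActMulti g.1))

/-- Unfolding `T₃`. [folklore] -/
theorem T₃_apply (F : 𝓢((Fin 3 → E4), ℂ)) :
    T₃ F = ∑ g : SignedPerm, ∑ τ : Equiv.Perm (Fin 3), I (permTest τ (linActMulti g.1 F)) := by
  simp [T₃]

section Commute

variable {E : Type*} [NormedAddCommGroup E] [NormedSpace ℝ E] {n : ℕ}

/-- The diagonal isometry action commutes with permutations of the arguments. [folklore] -/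
theorem linActMulti_permTest (L : E ≃ₗᵢ[ℝ] E) (τ : Equiv.Perm (Fin n)) (F : 𝓢((Fin n → E), ℂ)) :
    linActMulti L (permTest τ F) = permTest τ (linActMulti L F) := by
  ext x; simp [linActMulti_apply, permTest_apply, Function.comp_def]

/-- `permTest` is multiplicative. [folklore] -/
theorem permTest_permTest (σ τ : Equiv.Perm (Fin n)) (F : 𝓢((Fin n → E), ℂ)) :
    permTest τ (permTest σ F) = permTest (τ * σ) F := by
  ext x; simp [permTest_apply, Function.comp_def]

/-- `linActMulti` is multiplicative (`R.trans g = g ∘ R`). [folklore] -/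
theorem linActMulti_linActMulti (L M : E ≃ₗᵢ[ℝ] E) (F : 𝓢((Fin n → E), ℂ)) :
    linActMulti L (linActMulti M F) = linActMulti (M.trans L) F := by
  ext x; simp [linActMulti_apply]

/-- Permutations commute with diagonal translations. [folklore] -/
theorem permTest_translateMulti (τ : Equiv.Perm (Fin n)) (b : E) (F : 𝓢((Fin n → E), ℂ)) :
    permTest τ (translateMulti b F) = translateMulti b (permTest τ F) := by
  ext x; simp [permTest_apply, translateMulti_apply, Function.comp_def]

/-- The identity acts trivially. [folklore] -/
theorem linActMulti_refl (F : 𝓢((Fin n → E), ℂ)) : linActMulti (LinearIsometryEquiv.refl ℝ E) F = F := by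
  ext x; rfl

/-- The identity permutation acts trivially. [folklore] -/
theorem permTest_one (F : 𝓢((Fin n → E), ℂ)) : permTest (1 : Equiv.Perm (Fin n)) F = F := by
  ext x; simp [permTest_apply]

end Commute

/-- `T₃` is symmetric under `S₃`. [folklore] -/
theorem T₃_permTest (π : Equiv.Perm (Fin 3)) (F : 𝓢((Fin 3 → E4), ℂ)) : T₃ (permTest π F) = T₃ F := by
  rw [T₃_apply, T₃_apply]
  refine Finset.sum_congr rfl fun g _ => ?_
  simp_rw [linActMulti_permTest, permTest_permTest]
  exact Fintype.sum_equiv (Equiv.mulRight π) _ _ fun τ => rfl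

/-- `T₃` is invariant under every signed permutation (proper or not). [folklore] -/
theorem T₃_linActMulti (R : SignedPerm) (F : 𝓢((Fin 3 → E4), ℂ)) : T₃ (linActMulti R.1 F) = T₃ F := by
  rw [T₃_apply, T₃_apply]
  simp_rw [linActMulti_linActMulti]
  exact Fintype.sum_equiv (SignedPerm.compEquiv R) _ _ fun g => rfl

/-- `T₃` is translation invariant. [folklore] -/
theorem T₃_translateMulti (b : E4) (F : 𝓢((Fin 3 → E4), ℂ)) : T₃ (translateMulti b F) = T₃ F := by
  rw [T₃_apply, T₃_apply]
  refine Finset.sum_congr rfl fun g _ => Finset.sum_congr rfl fun τ _ => ?_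
  rw [linActMulti_translateMulti, permTest_translateMulti, I_translateMulti]

/-! ## 4. The blind spot: `T₃` vanishes on time-separated test functions -/

/-- `F` is time-separated: wherever `F ≠ 0` the time coordinates are pairwise distinct. [folklore] -/
def IsTimeSeparated {n : ℕ} (F : 𝓢((Fin n → E4), ℂ)) : Prop :=
  ∀ x, F x ≠ 0 → Function.Injective fun i => x i 0

/-- **Blind spot.** `T₃ F = 0` for every time-separated `F`: all points fed to `F` lie in `𝒩`, whose
configurations have a coincidence on the axis that the signed permutation turns into time. [folklore] -/
theorem T₃_eq_zero_of_isTimeSeparated {F : 𝓢((Fin 3 → E4), ℂ)} (hF : IsTimeSeparated F) : T₃ F = 0 := by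
  rw [T₃_apply]
  refine Finset.sum_eq_zero fun g _ => Finset.sum_eq_zero fun τ _ => ?_
  rw [I_apply]
  refine integral_eq_zero_of_ae (Eventually.of_forall fun z => ?_)
  simp only [permTest_apply, linActMulti_apply, Pi.zero_apply]
  by_contra hne
  have hinj := hF _ hne
  obtain ⟨j, ε, -, hj⟩ := SignedPerm.symm_apply_zero g
  obtain ⟨i₁, i₂, hne12, hcoin⟩ := Ψ_coincidence z j
  have h := @hinj (τ.symm i₁) (τ.symm i₂) (by
    simp only [Function.comp_apply, Equiv.apply_symm_apply, hj, hcoin])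
  exact hne12 (τ.symm.injective h)



/-! ## The diagonal frame -/

section Frame

/-- A diagonal frame: the reflection taking `e₀` to `(e₀ + e₁)/√2`. [folklore] -/
theorem exists_frame : ∃ (R : E4 ≃ₗᵢ[ℝ] E4) (a : ℝ), a ^ 2 = 1 / 2 ∧ 0 < a ∧
    R (e 0) = a • e 0 + a • e 1 := by
  set a : ℝ := 1 / Real.sqrt 2 with ha_def
  have ha0 : 0 < a := by positivity
  have ha2 : a ^ 2 = 1 / 2 := by
    rw [ha_def, div_pow, one_pow, Real.sq_sqrt (by norm_num : (0 : ℝ) ≤ 2)]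
  set v : E4 := e 0 with hv
  set w : E4 := a • e 0 + a • e 1 with hw
  have hnorm : ‖v‖ = ‖w‖ := by
    have h1 : ‖v‖ = 1 := by rw [hv, EuclideanSpace.norm_eq]; simp [e]
    have h2 : ‖w‖ = 1 := by
      have hsum : ∑ i : Fin 4, ‖w i‖ ^ 2 = a ^ 2 + a ^ 2 := by
        rw [hw]; simp [Fin.sum_univ_four, e, PiLp.single_apply]
      rw [EuclideanSpace.norm_eq, hsum, ← two_mul, ha2]; norm_num
    rw [h1, h2]
  exact ⟨(Submodule.span ℝ {v - w})ᗮ.reflection, a, ha2, ha0, Submodule.reflection_sub hnorm⟩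

variable {R : E4 ≃ₗᵢ[ℝ] E4} {a : ℝ}

/-- Frame time: `(R⁻¹ p)⁰ = ⟨p, R e₀⟩ = a (p⁰ + p¹)`. [folklore] -/
theorem frame_time (hR : R (e 0) = a • e 0 + a • e 1) (p : E4) : (R.symm p) 0 = a * (p 0 + p 1) := by
  have h1 : (R.symm p) 0 = ⟪R.symm p, e 0⟫_ℝ := by rw [EuclideanSpace.inner_single_right]; simp
  rw [h1, LinearIsometryEquiv.inner_map_eq_flip, LinearIsometryEquiv.symm_symm, hR, inner_add_right,
    inner_smul_right, inner_smul_right, EuclideanSpace.inner_single_right, EuclideanSpace.inner_single_right]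
  simp; ring

end Frame

end Phantom

end Summit.QuantumFields.YangMills.Theorems.DiagonalMirrorRPR.Negative
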